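import Mathlib
import HarnessLib
import Summits.NavierStokesRegularity.NavierStokesRegularity.Theorems.TaylorModelRungThreeCertificateReadoutVInterpWinP
import Summits.NavierStokesRegularity.NavierStokesRegularity.Theorems.TaylorModelRungThreeCertificateReadoutVStepWinPN

/-!
# Crux K1b-DR (stmt-NavierStokesRegularity-23954), line `taylor-model` — v3 read-outs, K-SIDE part 5-WPN: the LAYOUT of the windowed
# read-outs with the Poincaré-corrected base landing and FULL-PRECISION reciprocals (engine-1 g70): the per-stage Boolean
# `checkReadoutStageWinPN'` and **`checkReadoutsWinPN' kitOf wT A WV`** (THE read-out Boolean of the PN-assembly)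

Same emitted data, same inputs (`roInWinP / roInWinP'` of part 5-WP) and the SAME records presented to `TaylorModelV.ReadoutsVP`
(`toReadoutDataWinP`, `toWinDataP` — their fields are the boxes `Y0/Y1/Z0c/Z1/VBw`, which do not depend on the verdict); only the step
is `readoutStepWinPN` (part 4-WPN: (R9p) and (R11) through `landBoxN/dlBoxN/psBoxN`).  The generator switches
`checkReadoutsWinP'` ↦ `checkReadoutsWinPN'` and the closer to a `…PN` variant.

* `roOutWinPN / roOutWinPN'` (+ `_eq`), `checkReadoutStageWinPN'` (+ `_eq`), `checkReadoutsWinPN'`, `roOutWinPN_ok`;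
* `roOutWinPN_Y0/_Y1/_Z0/_Z1/_VB` — the output boxes of the PN step are those of the P step (`rfl`).

Definitions + `rfl`/rewrite lemmas only.  HONEST FRAMING: kernel bookkeeping for the MODEL certificate №23954 (rung TL-M3);
nothing here is a statement about the Navier–Stokes equations, and nothing is asserted.
-/

-- the sub-problem namespace repeats the summit name by design (D-0017)
set_option linter.dupNamespace false

namespace Summit.NavierStokesRegularity.NavierStokesRegularity.Theorems.TaylorModelCert

open scoped BigOperators
open Literature.Analysis.FluidPDE.TaoCascade Literature.Analysis.FluidPDE.TaoCascade.TaylorChain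
open Summit.NavierStokesRegularity.NavierStokesRegularity.Theorems.TaylorModelV

namespace CertTablesV

section Defs

variable (TV : CertTablesV) (kitOf : ℕ → CoreKit) (wT : ℕ → Array Dyad) (A : ReadoutAux QS2) (WV : WindowsV)

/-- The PN read-out step output of stage `j`. [folklore] -/
def roOutWinPN (j : ℕ) : ROOutWin := TV.base.readoutStepWinPN (TV.roInWinP kitOf wT A WV j)

/-- The PN read-out step output of stage `j`, checkpoint form. [folklore] -/
def roOutWinPN' (j : ℕ) : ROOutWin := TV.base.readoutStepWinPN (TV.roInWinP' kitOf wT A WV j)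

/-- `roOutWinPN'` is `roOutWinPN`. [folklore] -/
theorem roOutWinPN'_eq (j : ℕ) : TV.roOutWinPN' kitOf wT A WV j = TV.roOutWinPN kitOf wT A WV j := by
  simp only [roOutWinPN', roOutWinPN, roInWinP'_eq]

/-- **Per-stage PN read-out check, checkpoint form.** [folklore] -/
def checkReadoutStageWinPN' (j : ℕ) : Bool := (TV.roOutWinPN' kitOf wT A WV j).ok

/-- **All stages, checkpoint form**, plus the surrogate certification — THE READ-OUT BOOLEAN OF THE PN-ASSEMBLY. [folklore] -/
def checkReadoutsWinPN' : Bool :=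
  TV.base.checkReadoutAux A && allN (TV.base.N₀ + 1) fun j => TV.checkReadoutStageWinPN' kitOf wT A WV j

/-- `checkReadoutStageWinPN'` is the verdict of the semantic-form step. [folklore] -/
theorem checkReadoutStageWinPN'_eq (j : ℕ) : TV.checkReadoutStageWinPN' kitOf wT A WV j = (TV.roOutWinPN kitOf wT A WV j).ok := by
  simp only [checkReadoutStageWinPN', roOutWinPN'_eq]

end Defs

/-! ### Field reductions (all definitional) -/

section Rfl

variable {TV : CertTablesV} {kitOf : ℕ → CoreKit} {wT : ℕ → Array Dyad} {A : ReadoutAux QS2} {WV : WindowsV}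

/-- [folklore] -/
theorem roOutWinPN_ok (j : ℕ) : (TV.roOutWinPN kitOf wT A WV j).ok = (TV.base.readoutStepWinPN (TV.roInWinP kitOf wT A WV j)).ok := rfl
/-- [folklore] -/
theorem roOutWinPN_Y0 (j : ℕ) : (TV.roOutWinPN kitOf wT A WV j).Y0 = (TV.roOutWinP kitOf wT A WV j).Y0 := rfl
/-- [folklore] -/
theorem roOutWinPN_Y1 (j : ℕ) : (TV.roOutWinPN kitOf wT A WV j).Y1 = (TV.roOutWinP kitOf wT A WV j).Y1 := rfl
/-- [folklore] -/
theorem roOutWinPN_Z0 (j : ℕ) : (TV.roOutWinPN kitOf wT A WV j).Z0 = (TV.roOutWinP kitOf wT A WV j).Z0 := rfl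
/-- [folklore] -/
theorem roOutWinPN_Z1 (j : ℕ) : (TV.roOutWinPN kitOf wT A WV j).Z1 = (TV.roOutWinP kitOf wT A WV j).Z1 := rfl
/-- [folklore] -/
theorem roOutWinPN_VB (j : ℕ) : (TV.roOutWinPN kitOf wT A WV j).VB = (TV.roOutWinP kitOf wT A WV j).VB := rfl

end Rfl

end CertTablesV

end Summit.NavierStokesRegularity.NavierStokesRegularity.Theorems.TaylorModelCert
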